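import Summits.ABC.ABC.Theses.RibetTakahashiSplit
import Summits.ABC.ABC.Theses.DefiniteXi
import Literature.NumberTheory.EllipticCurves.DegreeConjectureAbc
import Literature.NumberTheory.EllipticCurves.SzpiroBGEquivalenceProofs
import Literature.NumberTheory.DiophantineGeometry.ConductorRadicalProofs
import Summits.ABC.ABC.Theorems.RibetTakahashiSplitWeightedSzpiroBoundSlackTransfer
import Summits.ABC.ABC.Theorems.RibetTakahashiSplitWeightedSzpiroBoundForgivenDegreeBoundOfDefiniteXi

/-!
# Route RibetTakahashiSplit — crux `WeightedSzpiroBound` (stmt-ABC-3272), line `two-adic-eisenstein-anchor`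

Lead's skeleton (reshaped from the planner's `Lines/two-adic-eisenstein-anchor.lean`, same
mathematics; presentational change only: the three stub signatures are written out in full with
fully-qualified names and no local `def`s, so that each stub can land verbatim as its own
`Theorems/RibetTakahashiSplitWeightedSzpiroBound<Stub>.lean` file and this file stays a pure
proof file).  See `Lines/two-adic-eisenstein-anchor.md` (the line card) for the prose.

Shape (after wave 1): registered stubs `stub_twoAdicAnchor` (the card's lever; open research),
`stub_forgivenDegreeBound_of_definiteXi` (reshape of the planner's ABC-strength stub 2 into the
explicit service by route `DefiniteXi`'s items; provable now) and `stub_slackTransfer` (LANDED,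
p74870), and the ADMIT-FREE composition `WeightedSzpiroBound_of`, which concludes the crux decl
`Summit.ABC.ABC.Theses.RibetTakahashiSplit.WeightedSzpiroBound` BY NAME from the stubs and FOUR
registered obligations of route `DefiniteXi`: modularity of Frey curves in datum form
(`DefiniteXi.FreyModularity`, stmt-ABC-11340), the Hoffstein–Lockhart / Murty Petersson lower bound
(`DefiniteXi.PeterssonLowerBound`, stmt-ABC-10870, verbatim the Literature named fact
`murty_petersson_newform_lower_bound`), the definite-quaternion crux `DefiniteXi.XiStrongBound`
(stmt-ABC-11337, ABC-strength) and the definite Ribet–Takahashi comparison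
`DefiniteXi.DefiniteRTControlPrime` (stmt-ABC-11338, known in print).  Logical geography (the crux
is ABC-equivalent — cdisprove `crux ⟸ GeneralizedSzpiroConjectureBG ⟸ ABC`): the line proves Frey's
degree conjecture with `|Δ_min|^ε` slack for Frey curves, split at the prime `2` into (S1) the
2-ADIC EISENSTEIN ANCHOR — the `2`-part of the minimal modular degree exceeds the Eisenstein
numerology `2^{e₂(N)}`, `e₂(N) = Σ_{p ∣ N, p odd} v₂(p² − 1)`, by at most `|Δ_min|^δ` — and (S2)
the degree conjecture with exactly that measured sporadic `2`-adic excess FORGIVEN (now drawn from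
`DefiniteXi`); (S3) Murty's theorem with slack turns the recombined bound into `abc` (≤-form), the
tree's `abcLe_iff_generalizedSzpiroBG_holds` into generalized Szpiro, and `T(E) ≥ 1` into the
weighted crux.  HONEST NOTE: given (S2) in its DefiniteXi form the full minimal-degree bound is
available and (S1) is not load-bearing for the composition; (S1) is kept registered because it is
this line's only own content (a kit-testable research statement about `𝕋(N)_{𝔪₂}`).
-/

noncomputable section

-- `Summit.<Summit>.<Problem>` is the mandated summit-side namespace (CONVENTIONS §2); for the
-- single-conjunct summit `ABC` the two coincide, so the duplicate `ABC.ABC` is deliberate.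
set_option linter.dupNamespace false

namespace Summit.ABC.ABC.Theorems.TwoAdicEisensteinAnchor

open Literature.NumberTheory
open Literature.NumberTheory.EllipticCurves
open Literature.NumberTheory.EllipticCurves.ModularForms
open Summit.ABC.ABC.Theses
open Summit.ABC.ABC.Theses.RibetTakahashiSplit (WeightedSzpiroBound)

/-! ## The three stubs (registered signatures; fully qualified, no local definitions)

Notation in the docstrings: `E = E_{a,b} = freyCurve a b : y² = x(x − a)(x + b)`, `N = N_E` its
conductor, `D` a modular parametrisation datum of `E` at level `N` (`ModularParametrizationData`:
newform, Néron-type lattice of this model, Manin constant `D.c ∈ ℤ ∖ {0}`, degree `D.deg`),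
"minimal" = of minimal degree among all data of that curve at that level,
`|Δ_min| = (freyCurve a b).minimalDiscriminantNorm ℤ`, `v₂ = padicValNat 2`,
`e₂(N) = ∑ p ∈ N.primeFactors.erase 2, v₂(p² − 1)` (the 2-adic Eisenstein exponent of the level). -/

/-- **Stub 1 — the 2-adic Eisenstein anchor** (the card's lever `K_B` in `|Δ_min|^δ` currency).
For every `δ > 0` there is `C` such that for every Frey curve and every MINIMAL datum `D` at level
`N = N_E`: `2^{v₂(deg D)} ≤ C · 2^{e₂(N)} · |Δ_min|^δ`, i.e.
`v₂(deg_min φ_E) ≤ e₂(N) + δ·log₂|Δ_min| + O_δ(1)`.  Why plausibly true: `ℓ = 2` is Eisenstein for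
`f_E` (`E[2] ⊂ E(ℚ)`), and every computable size invariant of `𝕋(N)_{𝔪₂}` (Eisenstein-ideal index,
cuspidal class number, component groups, Eisenstein-series depth) is `(p ± 1)`-numerology
`2^{e₂(N)+O(ω(N))}` or polynomial in `N`; the bet is that the sporadic 2-adic congruence depth of
`f_E` is `o(log|Δ_min|)`.  Why it might fail: a random model for the excess has maximum
`≈ θ·log₂ X` over conductors `≤ X`.  Size: L (research; open in print). -/
theorem stub_twoAdicAnchor :
    ∀ δ : ℝ, 0 < δ → ∃ C : ℝ, ∀ a b : ℤ, IsCoprime a b → a * b * (a + b) ≠ 0 →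
      ∀ (N : ℕ) [NeZero N],
        (Literature.NumberTheory.EllipticCurves.freyCurve a b).conductorNorm ℤ = N →
        ∀ D : Literature.NumberTheory.EllipticCurves.ModularForms.ModularParametrizationData
            (Literature.NumberTheory.EllipticCurves.freyCurve a b) N,
          (∀ D' : Literature.NumberTheory.EllipticCurves.ModularForms.ModularParametrizationData
              (Literature.NumberTheory.EllipticCurves.freyCurve a b) N, D.deg ≤ D'.deg) →
            (2 : ℝ) ^ padicValNat 2 D.deg ≤
              C * (2 : ℝ) ^ (∑ p ∈ N.primeFactors.erase 2, padicValNat 2 (p ^ 2 - 1)) *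
                (((Literature.NumberTheory.EllipticCurves.freyCurve a b).minimalDiscriminantNorm ℤ
                    : ℕ) : ℝ) ^ δ := by
  sorry

-- Stub 2′ `stub_forgivenDegreeBound_of_definiteXi` LANDED (p76459, ACCEPTED 2026-08-16T02:55Z):
-- `Summits/ABC/ABC/Theorems/RibetTakahashiSplitWeightedSzpiroBoundForgivenDegreeBoundOfDefiniteXi.lean`, same
-- namespace, imported above: `DefiniteXi.XiStrongBound → DefiniteXi.DefiniteRTControlPrime →` (the planner's forgiven
-- degree bound `deg D / 2^{(v₂(deg D) − e₂(N))⁺} ≤ C·(D.c)²·N^{2+ε}·|Δ_min|^ε` for minimal data), via the glue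
-- `definiteGlue_holds : DefiniteXi.DefiniteGlue` proved there.  (Reshape of the planner's ABC-strength stub 2 after
-- wave 1 returned `stub-blocked: DefiniteXi.XiStrongBound`.)

-- Stub 3 `stub_slackTransfer` LANDED (p74870, ACCEPTED 2026-08-16T01:55Z):
-- `Summits/ABC/ABC/Theorems/RibetTakahashiSplitWeightedSzpiroBoundSlackTransfer.lean`, same namespace,
-- imported above and invoked by name in `WeightedSzpiroBound_of`.

/-! ## Glue (fully proved) -/

/-- Recombination of the `2`-part and the forgiven part: stubs 1 and 2 and the EXISTENCE of a
datum on every Frey curve (modularity, item `DefiniteXi.FreyModularity`) give the slack degree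
bound (second hypothesis of stub 3).  A minimal-degree datum exists by `Nat.find`;
`deg = (deg / 2^k)·2^k` with `k = (v₂ − e₂)⁺` and `2^k ≤ max(C₁,1)·|Δ_min|^{ε/2}` in both cases
`e₂ ≤ v₂` / `v₂ < e₂`. [folklore] -/
theorem slackFreyDegreeBound_of_stubs (hMod : DefiniteXi.FreyModularity)
    (hXS : DefiniteXi.XiStrongBound) (hRT : DefiniteXi.DefiniteRTControlPrime) :
    ∀ ε : ℝ, 0 < ε → ∃ C : ℝ, ∀ a b : ℤ, IsCoprime a b → a * b * (a + b) ≠ 0 →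
      ∀ (N : ℕ) [NeZero N], (freyCurve a b).conductorNorm ℤ = N →
        ∃ D : ModularParametrizationData (freyCurve a b) N,
          (D.deg : ℝ) ≤ C * (D.c : ℝ) ^ 2 * (N : ℝ) ^ (2 + ε) *
            (((freyCurve a b).minimalDiscriminantNorm ℤ : ℕ) : ℝ) ^ ε := by
  intro ε hε
  have hε2 : 0 < ε / 2 := by positivity
  obtain ⟨C₁, hC₁⟩ := stub_twoAdicAnchor (ε / 2) hε2
  obtain ⟨C₂, hC₂⟩ := stub_forgivenDegreeBound_of_definiteXi hXS hRT (ε / 2) hε2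
  refine ⟨max C₂ 0 * max C₁ 1, fun a b hab h0 N _ hN ↦ ?_⟩
  -- a minimal-degree datum exists (modularity + well-ordering of ℕ)
  have hne : ∃ d : ℕ, ∃ D : ModularParametrizationData (freyCurve a b) N, D.deg = d := by
    obtain ⟨D₀⟩ := hMod a b hab h0 N hN
    exact ⟨D₀.deg, D₀, rfl⟩
  classical
  obtain ⟨D, hD⟩ := Nat.find_spec hne
  have hmin : ∀ D' : ModularParametrizationData (freyCurve a b) N, D.deg ≤ D'.deg := fun D' ↦ by
    rw [hD]; exact Nat.find_min' hne ⟨D', rfl⟩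
  refine ⟨D, ?_⟩
  have hS1 := hC₁ a b hab h0 N hN D hmin   -- 2^v ≤ C₁ 2^e Δ^(ε/2)
  have hS2 := hC₂ a b hab h0 N hN D hmin   -- deg/2^(v-e) ≤ C₂ c² N^(2+ε/2) Δ^(ε/2)
  have hΔpos : 0 < (freyCurve a b).minimalDiscriminantNorm ℤ :=
    WeierstrassCurve.minimalDiscriminantNorm_pos_holds (freyCurve a b)
  -- notation
  set Δ : ℝ := (((freyCurve a b).minimalDiscriminantNorm ℤ : ℕ) : ℝ) with hΔdef
  set v : ℕ := padicValNat 2 D.deg with hvdef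
  set e : ℕ := ∑ p ∈ N.primeFactors.erase 2, padicValNat 2 (p ^ 2 - 1) with hedef
  set k : ℕ := v - e with hkdef
  have hΔ1 : (1 : ℝ) ≤ Δ := by rw [hΔdef]; exact Nat.one_le_cast.mpr hΔpos
  have hΔ0 : (0 : ℝ) < Δ := one_pos.trans_le hΔ1
  have hN1 : (1 : ℝ) ≤ (N : ℝ) := Nat.one_le_cast.mpr (Nat.one_le_iff_ne_zero.mpr (NeZero.ne N))
  have hrpow0 : ∀ t : ℝ, (0 : ℝ) ≤ Δ ^ t := fun t ↦ Real.rpow_nonneg hΔ0.le t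
  -- exact division: deg = (deg / 2^k) * 2^k
  have hdvd : 2 ^ k ∣ D.deg :=
    (pow_dvd_pow 2 (Nat.sub_le v e)).trans pow_padicValNat_dvd
  have hdeg : (D.deg : ℝ) = ((D.deg / 2 ^ k : ℕ) : ℝ) * (2 : ℝ) ^ k := by
    have h := (Nat.div_mul_cancel hdvd).symm
    exact_mod_cast h
  -- the 2-part beyond the numerology
  have hk : (2 : ℝ) ^ k ≤ max C₁ 1 * Δ ^ (ε / 2) := by
    rcases Nat.lt_or_ge v e with hve | hev
    · have hk0 : k = 0 := by rw [hkdef]; exact Nat.sub_eq_zero_of_le hve.le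
      rw [hk0, pow_zero]
      exact one_le_mul_of_one_le_of_one_le (le_max_right _ _) (Real.one_le_rpow hΔ1 hε2.le)
    · have hsplit : (2 : ℝ) ^ k * (2 : ℝ) ^ e = (2 : ℝ) ^ v := by
        rw [hkdef, pow_sub_mul_pow (2 : ℝ) hev]
      have h2e : (0 : ℝ) < (2 : ℝ) ^ e := by positivity
      have h' : (2 : ℝ) ^ k * (2 : ℝ) ^ e ≤ (max C₁ 1 * Δ ^ (ε / 2)) * (2 : ℝ) ^ e := by
        rw [hsplit]
        calc (2 : ℝ) ^ v ≤ C₁ * (2 : ℝ) ^ e * Δ ^ (ε / 2) := hS1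
          _ ≤ max C₁ 1 * (2 : ℝ) ^ e * Δ ^ (ε / 2) :=
              mul_le_mul_of_nonneg_right (mul_le_mul_of_nonneg_right (le_max_left _ _) h2e.le)
                (hrpow0 _)
          _ = (max C₁ 1 * Δ ^ (ε / 2)) * (2 : ℝ) ^ e := by ring
      exact le_of_mul_le_mul_right h' h2e
  -- assemble
  have hc2 : (0 : ℝ) ≤ (D.c : ℝ) ^ 2 := sq_nonneg _
  have hNpow : (N : ℝ) ^ (2 + ε / 2) ≤ (N : ℝ) ^ (2 + ε) :=
    Real.rpow_le_rpow_of_exponent_le hN1 (by linarith)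
  have hΔsplit : Δ ^ (ε / 2) * Δ ^ (ε / 2) = Δ ^ ε := by
    rw [← Real.rpow_add hΔ0]; ring_nf
  have hb : (0 : ℝ) ≤ max C₂ 0 * (D.c : ℝ) ^ 2 * (N : ℝ) ^ (2 + ε / 2) * Δ ^ (ε / 2) :=
    mul_nonneg (mul_nonneg (mul_nonneg (le_max_right _ _) hc2) (Real.rpow_nonneg (Nat.cast_nonneg N) _))
      (hrpow0 _)
  have hK : (0 : ℝ) ≤ max C₂ 0 * max C₁ 1 * (D.c : ℝ) ^ 2 :=
    mul_nonneg (mul_nonneg (le_max_right _ _) (zero_le_one.trans (le_max_right _ _))) hc2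
  calc (D.deg : ℝ) = ((D.deg / 2 ^ k : ℕ) : ℝ) * (2 : ℝ) ^ k := hdeg
    _ ≤ (max C₂ 0 * (D.c : ℝ) ^ 2 * (N : ℝ) ^ (2 + ε / 2) * Δ ^ (ε / 2)) *
          (max C₁ 1 * Δ ^ (ε / 2)) := by
        refine mul_le_mul ?_ hk (by positivity) hb
        calc ((D.deg / 2 ^ k : ℕ) : ℝ) ≤ C₂ * (D.c : ℝ) ^ 2 * (N : ℝ) ^ (2 + ε / 2) * Δ ^ (ε / 2) := hS2
          _ ≤ max C₂ 0 * (D.c : ℝ) ^ 2 * (N : ℝ) ^ (2 + ε / 2) * Δ ^ (ε / 2) :=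
              mul_le_mul_of_nonneg_right (mul_le_mul_of_nonneg_right
                (mul_le_mul_of_nonneg_right (le_max_left _ _) hc2)
                (Real.rpow_nonneg (Nat.cast_nonneg N) _)) (hrpow0 _)
    _ = (max C₂ 0 * max C₁ 1) * (D.c : ℝ) ^ 2 * (N : ℝ) ^ (2 + ε / 2) *
          (Δ ^ (ε / 2) * Δ ^ (ε / 2)) := by ring
    _ ≤ (max C₂ 0 * max C₁ 1) * (D.c : ℝ) ^ 2 * (N : ℝ) ^ (2 + ε) * Δ ^ ε := by
        rw [hΔsplit]
        exact mul_le_mul_of_nonneg_right (mul_le_mul_of_nonneg_left hNpow hK) (hrpow0 _)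

/-- `T(E) ≥ 1`: every prime of the conductor divides the minimal discriminant (same radical,
`radical_conductorNorm_eq_holds`, PROVED), so each factor `ord_p(Δ_min)` of the weight is `≥ 1`.
[folklore] -/
theorem one_le_tamWeight (W : WeierstrassCurve ℚ) [W.IsElliptic] :
    1 ≤ ∏ p ∈ (W.conductorNorm ℤ).primeFactors with ¬ p ^ 2 ∣ W.conductorNorm ℤ,
      (W.minimalDiscriminantNorm ℤ).factorization p := by
  have hrad : UniqueFactorizationMonoid.radical (W.conductorNorm ℤ) =
      UniqueFactorizationMonoid.radical (W.minimalDiscriminantNorm ℤ) :=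
    W.radical_conductorNorm_eq_holds
  have hpf : (W.conductorNorm ℤ).primeFactors = (W.minimalDiscriminantNorm ℤ).primeFactors := by
    rw [← Nat.primeFactors_radical, hrad, Nat.primeFactors_radical]
  refine Nat.one_le_iff_ne_zero.mpr (Finset.prod_ne_zero_iff.mpr fun p hp ↦ ?_)
  rw [Finset.mem_filter] at hp
  have hp' : p ∈ (W.minimalDiscriminantNorm ℤ).primeFactors := hpf ▸ hp.1
  obtain ⟨hpp, hpd, hne⟩ := Nat.mem_primeFactors.mp hp'
  exact (hpp.factorization_pos_of_dvd hne hpd).ne'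

/-- **The crux from the line** — admit-free composition; the ONLY theorem of this file concluding
`Summit.ABC.ABC.Theses.RibetTakahashiSplit.WeightedSzpiroBound`, BY NAME.  Hypotheses: four
registered obligations shared with route `DefiniteXi` (modularity of Frey curves in datum form, item
`DefiniteXi.FreyModularity` = stmt-ABC-11340; the Petersson lower bound, item
`DefiniteXi.PeterssonLowerBound` = stmt-ABC-10870; `DefiniteXi.XiStrongBound` = stmt-ABC-11337;
`DefiniteXi.DefiniteRTControlPrime` = stmt-ABC-11338); the three stubs are INVOKED.  Chain: stubs 1+2 +
modularity ⟹ slack degree bound (`slackFreyDegreeBound_of_stubs`) ⟹ (stub 3 + Petersson) `abc` in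
`≤`-form ⟹ (`abcLe_iff_generalizedSzpiroBG_holds`, Bombieri–Gubler 12.5.12, PROVED in the tree)
`GeneralizedSzpiroConjectureBG` ⟹ (`T(E) ≥ 1`, `one_le_tamWeight`) the weighted crux. [folklore] -/
theorem WeightedSzpiroBound_of (hMod : DefiniteXi.FreyModularity) (hP : DefiniteXi.PeterssonLowerBound)
    (hXS : DefiniteXi.XiStrongBound) (hRT : DefiniteXi.DefiniteRTControlPrime) :
    WeightedSzpiroBound := by
  have habc := stub_slackTransfer hP (slackFreyDegreeBound_of_stubs hMod hXS hRT)
  have hBG : GeneralizedSzpiroConjectureBG := abcLe_iff_generalizedSzpiroBG_holds.mp habc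
  -- generalized Szpiro ⟹ the weighted crux, by `T(E) ≥ 1`
  intro ε hε
  obtain ⟨C, hC⟩ := hBG ε hε
  refine ⟨max C 0, fun W₀ hE hmin _hss ↦ ?_⟩
  haveI := hE
  have h1 := hC W₀ hE hmin
  set Nr : ℝ := (((W₀.baseChange ℚ).conductorNorm ℤ : ℕ) : ℝ) with hNr
  set Tr : ℝ := ((∏ p ∈ ((W₀.baseChange ℚ).conductorNorm ℤ).primeFactors with
      ¬ p ^ 2 ∣ (W₀.baseChange ℚ).conductorNorm ℤ,
        ((W₀.baseChange ℚ).minimalDiscriminantNorm ℤ).factorization p : ℕ) : ℝ) with hTr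
  have hN0 : (0 : ℝ) ≤ Nr := Nat.cast_nonneg _
  have hT1 : (1 : ℝ) ≤ Tr := by
    rw [hTr]; exact_mod_cast one_le_tamWeight (W₀.baseChange ℚ)
  have hle : Nr ≤ Nr * Tr := le_mul_of_one_le_right hN0 hT1
  have hexp : (0 : ℝ) ≤ 6 + ε := by linarith
  have hpow : Nr ^ (6 + ε) ≤ (Nr * Tr) ^ (6 + ε) := Real.rpow_le_rpow hN0 hle hexp
  have hpow0 : (0 : ℝ) ≤ Nr ^ (6 + ε) := Real.rpow_nonneg hN0 _
  calc ((max |W₀.Δ| (|W₀.c₄| ^ 3) : ℤ) : ℝ) ≤ C * Nr ^ (6 + ε) := h1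
    _ ≤ max C 0 * Nr ^ (6 + ε) := mul_le_mul_of_nonneg_right (le_max_left _ _) hpow0
    _ ≤ max C 0 * (Nr * Tr) ^ (6 + ε) := mul_le_mul_of_nonneg_left hpow (le_max_right _ _)

end Summit.ABC.ABC.Theorems.TwoAdicEisensteinAnchor

end
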